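import Summits.BirchSwinnertonDyer.Rank1Residual.X4.OldEigenSymbOfLevelLower
import Literature.NumberTheory.EllipticCurves.ModularCurveIharaLemma
import HarnessLib

/-!
# (OLD) from Ihara's lemma BY NAME: the non-vanishing of the `ℓ`-old shape `μ − w·μ∘[ℓ]` (cell `b2b-bsdres`, seat additive-p4, line V44)

HONEST FRAMING (verbatim, cell `b2b-bsdres`): the goal of the cell is to DELETE the COMBINATION-SHAPED
residual classes for ALL analytic-rank `≤ 1` curves over `ℚ` — "full BSD formula for every rank `≤ 1`
curve in class `C`" assembled STRICTLY from published theorems — so that the rank-`≤ 1` remainder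
becomes exactly the CONSTRUCTION-SHAPED classes, which are TYPED (missing-input Props), NOT attempted;
this is not "finishing BSD". This file: TOOL theorems (pure algebra over the tree's period homology
`H₁(X₀(N), ℤ) = periodHomology N ⊆ S₂(Γ₀(N))^∨`), 0 defs, 0 facts, nothing booked; X4
CONSTRUCTION-SHAPED. It is the FIRST CONSUMER BY NAME of the landed named fact
`Literature.NumberTheory.EllipticCurves.ModularForms.ribet1984_iharaLemma` (cc-typer-1, p318719:
Ihara's lemma in the `Γ₀`-cokernel form of Darmon–Diamond–Taylor Lemma 4.28 (a) + Lemma 4.30 (b) /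
Diamond–Ribet §4.4 (10), Lemma 4.6; primary Ribet 1984 Thm. 4.1).

## What is proved

Gen 23's K9 (`X4/OldEigenSymbOfLevelLower`) reduced the displayed hypothesis (OLD)
`HasOldEigenPlusSymb k (Mℓ) θ' ℓ w μ` to LEVEL-`M` data on `μ : ℚ → k` (periodic, even, symbol in
`Symb_{Γ₀(M)}`, Hecke / Atkin–Lehner relations, the root `α` with `w α = 1`) plus ONE non-vanishing
`∃ r, μ(r) ≠ w μ(ℓ r)` — "Ihara's lemma". Here that non-vanishing is DERIVED from the named fact:

* §1 `dualMap_degeneracyMap0_periodFunctional_apply`: for `M d ∣ N` and `γ ∈ Γ₀(N)` with finite cusp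
  `γ∞ = a/c`, the push-forward `α_{d,*}{∞, γ∞}_N` is the path functional `f ↦ {∞, d·(a/c)}_f` of level
  `M` (Cremona §2.4 (2.4.1)–(2.4.2); the tree's `modularSymbol_slash_tpD`, `coe_degeneracyMap0`).
* §2 `exists_apply_dualMap_sub_ne_zero_of_ribet1984_iharaLemma` — IHARA IN THE DUAL (INJECTIVITY)
  FORM: let `Λ` be a `k`-valued function on `S₂(Γ₀(M))^∨` whose restriction to `H₁(X₀(M), ℤ)` is an
  eigenvector of the prime-to-`Mℓ` Hecke ring `𝕋̃` with character `χ : 𝕋̃ → k`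
  (`Λ(s·x) = χ(s) Λ(x)` on the lattice), `ker χ` maximal, of residue characteristic `≠ 2`
  (`(2 : k) ≠ 0`) and NOT Eisenstein, and `Λ(x) ≠ 0` for some cycle `x`. Then for every `w ∈ k` the
  level-`Mℓ` functional `z ↦ Λ(α_* z) − w Λ(β_* z)` does not vanish on `H₁(X₀(Mℓ), ℤ)`. PROOF: the
  fact gives `s ∉ ker χ` and `z` with `α_* z = s·x`, `β_* z = s·0 = 0`; so the value is `χ(s) Λ(x)`,
  and `χ(s)` is a UNIT of `k` (`ker χ` maximal ⟹ `s` invertible mod `ker χ`), `Λ(x) ≠ 0`.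
  Additivity of `Λ` is not even used (only `Λ(0) = 0`, which the eigen-relation forces).
* §3 `exists_sub_mul_apply_ne_zero_of_ribet1984_iharaLemma`: if moreover `μ : ℚ → k` is CARRIED by
  `Λ` on closed paths — `μ(r) = Λ(x)` whenever the cycle `x ∈ H₁(X₀(M), ℤ)` is the path functional
  `f ↦ {∞, r}_f` — then `∃ r, μ(r) − w μ(ℓ r) ≠ 0` (every cycle of level `Mℓ` is `{∞, γ∞}`,
  `coe_periodHomology_eq_range`; `α_*{∞, γ∞} = {∞, γ∞}`, `β_*{∞, γ∞} = {∞, ℓ·γ∞}` by §1).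
* §4 `hasOldEigenPlusSymb_of_ribet1984_iharaLemma` (+ minus twin): K9's
  `hasOldEigen{Plus,Minus}Symb_of_levelLower` with the binder `hne` REPLACED by
  `ribet1984_iharaLemma` (BY NAME) + the carrying eigen-functional `Λ` and its character.

WHAT REMAINS DISPLAYED for the typer of (OLD) after this file (node (T2′) of the lane): the EXISTENCE
of the level-`M` datum `(μ, Λ, χ, θ)` — the reduced, suitably normalised modular symbol of Ribet's
level-`M` form `g` (Ribet 1990 Thm. 1.1 / `diamond1995_refinedSerre`) read in `k ⊇ 𝔽_p`: `μ` its
values on paths `{∞, r}`, `Λ` its values on cycles, `χ` its prime-to-`Mℓ` eigencharacter (non-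
Eisenstein = `ρ̄` irreducible, DDT Lemma 4.12), `θ` its full eigen-system. Nothing of that is
asserted here.

## References

* K. A. Ribet, *Congruence relations between modular forms*, Proc. ICM 1983 (PWN 1984), Thm. 4.1. [cite: Ribet1984ICM, Thm. 4.1]
* H. Darmon, F. Diamond, R. Taylor, *Fermat's Last Theorem* (CDM 1995), Lemma 4.28 (a), Lemma 4.30, §4.5 p. 137; Lemma 4.12 (p. 120). [cite: DarmonDiamondTaylor1995, Lemma 4.28 (a), Lemma 4.30 (b), §4.5 pp. 135–137]
* F. Diamond, K. Ribet, in *Modular Forms and Fermat's Last Theorem* (1997), §4.4 (10), Lemma 4.6. [cite: DiamondRibet1997, §4.4 Lemma 4.6]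
* J. E. Cremona, *Algorithms for modular elliptic curves* (1997), §2.1, §2.4. [cite: CremonaAlgorithms1997, §2.4]
* K. A. Ribet, Invent. Math. 100 (1990), Thm. 1.1. [cite: Ribet1990, Thm. 1.1]
-/

noncomputable section

open scoped MatrixGroups ModularForm

open CongruenceSubgroup Finset Matrix

open Literature.NumberTheory.EllipticCurves Literature.NumberTheory.EllipticCurves.ModularForms
  Literature.NumberTheory.EllipticCurves.ModularForms.HidaCohomology

namespace Summit.BirchSwinnertonDyer.Rank1Residual.LevelLowering

/-! ### §1 Period functionals under the degeneracy maps, with the cusp exposed -/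

section Degeneracy

variable {M N d : ℕ} [NeZero M] [NeZero N] [NeZero d]

/-- **`α_{d,*}{∞, γ∞}_N = {∞, d·γ∞}` as a path functional of level `M`.** For `M d ∣ N`,
`γ = (a b; c e) ∈ Γ₀(N)` with `c ≠ 0` and `f ∈ S₂(Γ₀(M))`:
`(α_{d,*}{∞, γ∞})(f) = {∞, γ∞}_{f ∣ diag(d,1)} = {∞, d·(a/c)}_f` (Cremona 1997, §2.4,
(2.4.1)–(2.4.2); Darmon–Diamond–Taylor Lemma 4.28: `α : τ ↦ τ`, `β : τ ↦ pτ`).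
[cite: CremonaAlgorithms1997, §2.4] -/
theorem dualMap_degeneracyMap0_periodFunctional_apply (h : M * d ∣ N) (γ : Gamma0 N)
    (hc : (γ : SL(2, ℤ)) 1 0 ≠ 0) (f : CuspForm (Gamma0 M) 2) :
    (degeneracyMap0 M N d 2).dualMap (periodFunctional N γ) f =
      modularSymbol f (d * (((γ : SL(2, ℤ)) 0 0 : ℚ) / ((γ : SL(2, ℤ)) 1 0 : ℚ))) := by
  rw [LinearMap.dualMap_apply, periodFunctional_apply, cuspSymbol, if_neg hc,
    ← modularSymbol_slash_tpD d f, modularSymbol, coe_degeneracyMap0 M N d 2 h f]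

/-- The period functional of `γ` with `γ∞ = ∞` (`c = 0`) is `0`. [folklore] -/
theorem periodFunctional_eq_zero_of_apply_eq_zero (γ : Gamma0 N) (hc : (γ : SL(2, ℤ)) 1 0 = 0) :
    periodFunctional N γ = 0 := by
  ext f
  rw [periodFunctional_apply, cuspSymbol, if_pos hc, LinearMap.zero_apply]

end Degeneracy

/-! ### §2 Ihara's lemma in the dual form: `Λ∘α_* − w·Λ∘β_* ≠ 0` on `H₁(X₀(Mℓ), ℤ)` -/

section Ihara

variable {k : Type*} [CommRing k] {M : ℕ} [NeZero M] {ℓ : ℕ} [Fact ℓ.Prime]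

/-- For a ring map `χ` with MAXIMAL kernel, `χ(s)` is a unit for every `s ∉ ker χ`
(`s` is invertible in the field `R ⧸ ker χ`). [folklore] -/
theorem isUnit_map_of_not_mem_ker {R : Type*} [CommRing R] (χ : R →+* k)
    (h𝔫 : (RingHom.ker χ).IsMaximal) {s : R} (hs : s ∉ RingHom.ker χ) : IsUnit (χ s) := by
  letI := Ideal.Quotient.field (RingHom.ker χ)
  have hne : Ideal.Quotient.mk (RingHom.ker χ) s ≠ 0 := by
    rwa [Ne, Ideal.Quotient.eq_zero_iff_mem]
  have hu : IsUnit (Ideal.Quotient.mk (RingHom.ker χ) s) := hne.isUnit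
  simpa using hu.map (RingHom.kerLift χ)

omit [Fact ℓ.Prime] in
/-- The eigen-relation on the lattice forces `Λ(0) = 0`. [folklore] -/
theorem apply_zero_eq_zero_of_eigen (Λ : Module.Dual ℂ (CuspForm (Gamma0 M) 2) → k)
    (χ : HeckeRing0.primeTo M 2 (M * ℓ) →+* k)
    (hΛ : ∀ (s : HeckeRing0.primeTo M 2 (M * ℓ)), ∀ x ∈ periodHomology M,
      Λ ((s : HeckeRing0 M 2) • x) = χ s * Λ x) :
    Λ 0 = 0 := by
  have h := hΛ 0 0 (zero_mem _)
  rwa [map_zero, zero_mul, ZeroMemClass.coe_zero, zero_smul] at h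

/-- **IHARA'S LEMMA, DUAL (INJECTIVITY) FORM, from the named fact `ribet1984_iharaLemma`.** Let
`ℓ ∤ M` be prime, `Λ` a `k`-valued function on `S₂(Γ₀(M))^∨` whose restriction to the period
homology `H₁(X₀(M), ℤ)` is an eigenvector of the prime-to-`Mℓ` Hecke ring `𝕋̃` with character `χ`
(`Λ(s·x) = χ(s)Λ(x)`), `ker χ` maximal, `(2 : k) ≠ 0` (odd residue characteristic), `ker χ` NOT
Eisenstein, and `Λ(x) ≠ 0` for some cycle `x`. Then for every `w ∈ k` there is a cycle
`z ∈ H₁(X₀(Mℓ), ℤ)` with `Λ(α_* z) − w·Λ(β_* z) ≠ 0`. (From the fact: `s ∉ ker χ` and `z` with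
`α_* z = s·x`, `β_* z = s·0 = 0`, so the value is `χ(s)Λ(x)` with `χ(s)` a unit — Ribet 1984
Thm. 4.1 / Darmon–Diamond–Taylor Lemma 4.28 (a) + 4.30 (b), read on `Hom(H₁, k)`.)
[cite: Ribet1984ICM, Thm. 4.1] [cite: DarmonDiamondTaylor1995, Lemma 4.28 (a), Lemma 4.30 (b), §4.5 pp. 135–137] -/
theorem exists_apply_dualMap_sub_ne_zero_of_ribet1984_iharaLemma (hI : ribet1984_iharaLemma)
    (hℓM : ¬ ℓ ∣ M) (Λ : Module.Dual ℂ (CuspForm (Gamma0 M) 2) → k)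
    (χ : HeckeRing0.primeTo M 2 (M * ℓ) →+* k)
    (hΛ : ∀ (s : HeckeRing0.primeTo M 2 (M * ℓ)), ∀ x ∈ periodHomology M,
      Λ ((s : HeckeRing0 M 2) • x) = χ s * Λ x)
    (h𝔫 : (RingHom.ker χ).IsMaximal) (h2 : (2 : k) ≠ 0)
    (hE : ¬ HeckeRing0.primeTo.IsEisenstein (RingHom.ker χ))
    {x : Module.Dual ℂ (CuspForm (Gamma0 M) 2)} (hx : x ∈ periodHomology M) (hΛx : Λ x ≠ 0)
    (w : k) :
    ∃ z ∈ periodHomology (M * ℓ),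
      Λ ((degeneracyMap0 M (M * ℓ) 1 2).dualMap z) -
        w * Λ ((degeneracyMap0 M (M * ℓ) ℓ 2).dualMap z) ≠ 0 := by
  have h2' : (2 : HeckeRing0.primeTo M 2 (M * ℓ)) ∉ RingHom.ker χ := by
    rw [RingHom.mem_ker, map_ofNat]; exact h2
  obtain ⟨s, hs, hsur⟩ := hI M ℓ hℓM (RingHom.ker χ) h𝔫 h2' hE
  obtain ⟨z, hz, hα, hβ⟩ := hsur x hx 0 (zero_mem _)
  refine ⟨z, hz, ?_⟩
  rw [hα, hβ, smul_zero, apply_zero_eq_zero_of_eigen Λ χ hΛ, mul_zero, sub_zero, hΛ s x hx]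
  exact (isUnit_map_of_not_mem_ker χ h𝔫 hs).mul_right_eq_zero.not.mpr hΛx

/-! ### §3 The cusp-level consequence: `μ − w·μ∘[ℓ] ≢ 0` -/

/-- **THE `ℓ`-OLD SHAPE DOES NOT VANISH (Ihara, BY NAME).** In the situation of
`exists_apply_dualMap_sub_ne_zero_of_ribet1984_iharaLemma`, let `μ : ℚ → k` be CARRIED by `Λ` on
closed paths: `μ(r) = Λ(x)` whenever the cycle `x ∈ H₁(X₀(M), ℤ)` is the path functional
`f ↦ {∞, r}_f`. Then `μ(r) − w μ(ℓ r) ≠ 0` for some `r ∈ ℚ`: every cycle of level `Mℓ` is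
`{∞, γ∞}` for one `γ ∈ Γ₀(Mℓ)` (Manin), and `α_*{∞, γ∞} = {∞, γ∞}`, `β_*{∞, γ∞} = {∞, ℓ·γ∞}`
(Cremona §2.4). [cite: Ribet1984ICM, Thm. 4.1] [cite: CremonaAlgorithms1997, §2.4] -/
theorem exists_sub_mul_apply_ne_zero_of_ribet1984_iharaLemma (hI : ribet1984_iharaLemma)
    (hℓM : ¬ ℓ ∣ M) (Λ : Module.Dual ℂ (CuspForm (Gamma0 M) 2) → k)
    (χ : HeckeRing0.primeTo M 2 (M * ℓ) →+* k)
    (hΛ : ∀ (s : HeckeRing0.primeTo M 2 (M * ℓ)), ∀ x ∈ periodHomology M,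
      Λ ((s : HeckeRing0 M 2) • x) = χ s * Λ x)
    (h𝔫 : (RingHom.ker χ).IsMaximal) (h2 : (2 : k) ≠ 0)
    (hE : ¬ HeckeRing0.primeTo.IsEisenstein (RingHom.ker χ))
    {x : Module.Dual ℂ (CuspForm (Gamma0 M) 2)} (hx : x ∈ periodHomology M) (hΛx : Λ x ≠ 0)
    (w : k) {μ : ℚ → k}
    (hμΛ : ∀ y ∈ periodHomology M, ∀ r : ℚ,
      (∀ f : CuspForm (Gamma0 M) 2, y f = modularSymbol f r) → μ r = Λ y) :
    ∃ r : ℚ, μ r - w * μ (ℓ * r) ≠ 0 := by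
  obtain ⟨z, hz, hne⟩ :=
    exists_apply_dualMap_sub_ne_zero_of_ribet1984_iharaLemma hI hℓM Λ χ hΛ h𝔫 h2 hE hx hΛx w
  have hz' : z ∈ (periodHomology (M * ℓ) : Set (Module.Dual ℂ (CuspForm (Gamma0 (M * ℓ)) 2))) := hz
  rw [coe_periodHomology_eq_range] at hz'
  obtain ⟨γ, rfl⟩ := hz'
  have h1 : M * 1 ∣ M * ℓ := by rw [mul_one]; exact dvd_mul_right M ℓ
  have hℓ' : M * ℓ ∣ M * ℓ := dvd_rfl
  by_cases hc : (γ : SL(2, ℤ)) 1 0 = 0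
  · -- `γ∞ = ∞`: the cycle is `0`, contradicting the non-vanishing
    exfalso
    apply hne
    rw [periodFunctional_eq_zero_of_apply_eq_zero γ hc, map_zero, map_zero,
      apply_zero_eq_zero_of_eigen Λ χ hΛ, mul_zero, sub_zero]
  · set r : ℚ := ((γ : SL(2, ℤ)) 0 0 : ℚ) / ((γ : SL(2, ℤ)) 1 0 : ℚ) with hr
    refine ⟨r, ?_⟩
    have hα : μ r = Λ ((degeneracyMap0 M (M * ℓ) 1 2).dualMap (periodFunctional (M * ℓ) γ)) :=
      hμΛ _ (dualMap_degeneracyMap0_mem_periodHomology M (M * ℓ) 1 h1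
        (periodFunctional_mem_periodHomology (M * ℓ) γ)) r fun f ↦ by
          rw [dualMap_degeneracyMap0_periodFunctional_apply h1 γ hc f, Nat.cast_one, one_mul]
    have hβ : μ (ℓ * r) =
        Λ ((degeneracyMap0 M (M * ℓ) ℓ 2).dualMap (periodFunctional (M * ℓ) γ)) :=
      hμΛ _ (dualMap_degeneracyMap0_mem_periodHomology M (M * ℓ) ℓ hℓ'
        (periodFunctional_mem_periodHomology (M * ℓ) γ)) (ℓ * r) fun f ↦ by
          rw [dualMap_degeneracyMap0_periodFunctional_apply hℓ' γ hc f]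
    rwa [hα, hβ]

end Ihara

/-! ### §4 (OLD) / (OLD⁻) from level-`M` data + Ihara's lemma BY NAME -/

section OldShape

variable {k : Type*} [CommRing k] {μ : ℚ → k} {M : ℕ} [NeZero M] {ℓ : ℕ} [Fact ℓ.Prime]

/-- **(OLD) FROM ITS PUBLISHED CONTENT, IHARA BY NAME.** `HasOldEigenPlusSymb k (M * ℓ) θ' ℓ w μ`
follows from: a `1`-periodic even LEVEL-`M` eigen-function `μ` (symbol in `Symb_{Γ₀(M)}`, MTT /
Atkin–Lehner relations with system `θ`; the reduced symbol of Ribet's level-`M` form, Ribet 1990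
Thm. 1.1 / `diamond1995_refinedSerre` — NOT supplied here), the root `α` with `w α = 1`, and — in
place of K9's bare non-vanishing `hne` — the named fact `ribet1984_iharaLemma` together with the
eigen-functional `Λ` on `H₁(X₀(M), ℤ)` CARRYING `μ` on closed paths (prime-to-`Mℓ` character `χ`
with maximal, odd, non-Eisenstein kernel; `Λ ≠ 0` on some cycle).
[cite: Ribet1984ICM, Thm. 4.1] [cite: Ribet1990, Thm. 1.1] [cite: MazurTateTeitelbaum1986Invent, §I.10] -/
theorem hasOldEigenPlusSymb_of_ribet1984_iharaLemma (hI : ribet1984_iharaLemma)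
    (hper : IsPeriodic μ) (heven : ∀ r : ℚ, μ (-r) = μ r)
    (hΓ : potSymbOf μ ∈ (CoeffActionOn.symPowOn (sigma0Set M) 0 k).Symb (Gamma0 M))
    (θ : ℕ → k) (hT : ∀ q : ℕ, q.Prime → ¬ q ∣ M → HeckeRel μ q (θ q))
    (hU : ∀ q : ℕ, q.Prime → q ∣ M → ∀ r : ℚ, ∑ j ∈ Finset.range q, μ ((r + j) / q) = θ q * μ r)
    (hℓM : ¬ ℓ ∣ M) {α w : k} (hα : α ^ 2 - θ ℓ * α + ℓ = 0) (hw : w * α = 1)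
    (θ' : ℕ → k) (hθ' : ∀ q : ℕ, q ≠ ℓ → θ' q = θ q) (hθ'ℓ : θ' ℓ = α)
    -- Ihara's lemma BY NAME + the carrying eigen-functional on `H₁(X₀(M), ℤ)`
    (Λ : Module.Dual ℂ (CuspForm (Gamma0 M) 2) → k)
    (χ : HeckeRing0.primeTo M 2 (M * ℓ) →+* k)
    (hΛ : ∀ (s : HeckeRing0.primeTo M 2 (M * ℓ)), ∀ x ∈ periodHomology M,
      Λ ((s : HeckeRing0 M 2) • x) = χ s * Λ x)
    (h𝔫 : (RingHom.ker χ).IsMaximal) (h2 : (2 : k) ≠ 0)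
    (hE : ¬ HeckeRing0.primeTo.IsEisenstein (RingHom.ker χ))
    {x : Module.Dual ℂ (CuspForm (Gamma0 M) 2)} (hx : x ∈ periodHomology M) (hΛx : Λ x ≠ 0)
    (hμΛ : ∀ y ∈ periodHomology M, ∀ r : ℚ,
      (∀ f : CuspForm (Gamma0 M) 2, y f = modularSymbol f r) → μ r = Λ y) :
    HasOldEigenPlusSymb k (M * ℓ) θ' ℓ w μ :=
  hasOldEigenPlusSymb_of_levelLower hper heven hΓ θ hT hU hℓM hα hw θ' hθ' hθ'ℓ
    (exists_sub_mul_apply_ne_zero_of_ribet1984_iharaLemma hI hℓM Λ χ hΛ h𝔫 h2 hE hx hΛx w hμΛ)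

/-- **(OLD⁻) FROM ITS PUBLISHED CONTENT, IHARA BY NAME** (odd `μ`). [cite: Ribet1984ICM, Thm. 4.1]
[cite: Ribet1990, Thm. 1.1] [cite: MazurTateTeitelbaum1986Invent, §I.10] -/
theorem hasOldEigenMinusSymb_of_ribet1984_iharaLemma (hI : ribet1984_iharaLemma)
    (hper : IsPeriodic μ) (hodd : ∀ r : ℚ, μ (-r) = -μ r)
    (hΓ : potSymbOf μ ∈ (CoeffActionOn.symPowOn (sigma0Set M) 0 k).Symb (Gamma0 M))
    (θ : ℕ → k) (hT : ∀ q : ℕ, q.Prime → ¬ q ∣ M → HeckeRel μ q (θ q))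
    (hU : ∀ q : ℕ, q.Prime → q ∣ M → ∀ r : ℚ, ∑ j ∈ Finset.range q, μ ((r + j) / q) = θ q * μ r)
    (hℓM : ¬ ℓ ∣ M) {α w : k} (hα : α ^ 2 - θ ℓ * α + ℓ = 0) (hw : w * α = 1)
    (θ' : ℕ → k) (hθ' : ∀ q : ℕ, q ≠ ℓ → θ' q = θ q) (hθ'ℓ : θ' ℓ = α)
    (Λ : Module.Dual ℂ (CuspForm (Gamma0 M) 2) → k)
    (χ : HeckeRing0.primeTo M 2 (M * ℓ) →+* k)
    (hΛ : ∀ (s : HeckeRing0.primeTo M 2 (M * ℓ)), ∀ x ∈ periodHomology M,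
      Λ ((s : HeckeRing0 M 2) • x) = χ s * Λ x)
    (h𝔫 : (RingHom.ker χ).IsMaximal) (h2 : (2 : k) ≠ 0)
    (hE : ¬ HeckeRing0.primeTo.IsEisenstein (RingHom.ker χ))
    {x : Module.Dual ℂ (CuspForm (Gamma0 M) 2)} (hx : x ∈ periodHomology M) (hΛx : Λ x ≠ 0)
    (hμΛ : ∀ y ∈ periodHomology M, ∀ r : ℚ,
      (∀ f : CuspForm (Gamma0 M) 2, y f = modularSymbol f r) → μ r = Λ y) :
    HasOldEigenMinusSymb k (M * ℓ) θ' ℓ w μ :=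
  hasOldEigenMinusSymb_of_levelLower hper hodd hΓ θ hT hU hℓM hα hw θ' hθ' hθ'ℓ
    (exists_sub_mul_apply_ne_zero_of_ribet1984_iharaLemma hI hℓM Λ χ hΛ h𝔫 h2 hE hx hΛx w hμΛ)

end OldShape

/-! ### §5 The annihilator form of Ihara's lemma on `Hom(H₁, k)` (appended, gen 25): the kernel of
`(Λ₁, Λ₂) ↦ Λ₁∘α_* + Λ₂∘β_*` is killed by Ihara's element `s ∉ 𝔫` — no eigen-hypothesis on `Λ₁, Λ₂` -/

section Annihilator

variable {k : Type*} [CommRing k] {M : ℕ} [NeZero M] {ℓ : ℕ} [Fact ℓ.Prime]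

/-- **IHARA'S LEMMA, ANNIHILATOR FORM (from `ribet1984_iharaLemma`).** For `ℓ ∤ M` prime and a
maximal ideal `𝔫 ⊂ 𝕋̃ = ℤ[T_r : r ∤ Mℓ]` with `2 ∉ 𝔫`, NOT Eisenstein, there is `s ∈ 𝕋̃ ∖ 𝔫` such
that for ALL `k`-valued `Λ₁, Λ₂` on `S₂(Γ₀(M))^∨` with `Λ₁(0) = Λ₂(0) = 0`: if the level-`Mℓ`
functional `z ↦ Λ₁(α_* z) + Λ₂(β_* z)` vanishes on `H₁(X₀(Mℓ), ℤ)`, then `Λ₁(s·x) = Λ₂(s·x) = 0` for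
every cycle `x ∈ H₁(X₀(M), ℤ)` — i.e. the kernel of `π^* : (Λ₁, Λ₂) ↦ Λ₁∘α_* + Λ₂∘β_*` is annihilated by
`s`, the dual of "coker(α_*, β_*) is killed by `s`" (Ribet 1984 Thm. 4.1; Darmon–Diamond–Taylor Lemma
4.28 (a) + 4.30 (b)). No eigen-hypothesis: this is the form needed to extract EIGEN components from an
`ℓ`-old decomposition (generalised eigenspaces are `s`-divisible). [cite: Ribet1984ICM, Thm. 4.1]
[cite: DarmonDiamondTaylor1995, Lemma 4.28 (a), Lemma 4.30 (b), §4.5 pp. 135–137] -/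
theorem exists_forall_apply_smul_eq_zero_of_ribet1984_iharaLemma (hI : ribet1984_iharaLemma)
    (hℓM : ¬ ℓ ∣ M) (𝔫 : Ideal (HeckeRing0.primeTo M 2 (M * ℓ))) (h𝔫 : 𝔫.IsMaximal)
    (h2 : (2 : HeckeRing0.primeTo M 2 (M * ℓ)) ∉ 𝔫) (hE : ¬ HeckeRing0.primeTo.IsEisenstein 𝔫) :
    ∃ s : HeckeRing0.primeTo M 2 (M * ℓ), s ∉ 𝔫 ∧
      ∀ (Λ₁ Λ₂ : Module.Dual ℂ (CuspForm (Gamma0 M) 2) → k), Λ₁ 0 = 0 → Λ₂ 0 = 0 →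
        (∀ z ∈ periodHomology (M * ℓ),
          Λ₁ ((degeneracyMap0 M (M * ℓ) 1 2).dualMap z) +
            Λ₂ ((degeneracyMap0 M (M * ℓ) ℓ 2).dualMap z) = 0) →
        ∀ x ∈ periodHomology M,
          Λ₁ ((s : HeckeRing0 M 2) • x) = 0 ∧ Λ₂ ((s : HeckeRing0 M 2) • x) = 0 := by
  obtain ⟨s, hs, hsur⟩ := hI M ℓ hℓM 𝔫 h𝔫 h2 hE
  refine ⟨s, hs, fun Λ₁ Λ₂ h₁ h₂ hker x hx ↦ ⟨?_, ?_⟩⟩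
  · obtain ⟨z, hz, hα, hβ⟩ := hsur x hx 0 (zero_mem _)
    have h := hker z hz
    rwa [hα, hβ, smul_zero, h₂, add_zero] at h
  · obtain ⟨z, hz, hα, hβ⟩ := hsur 0 (zero_mem _) x hx
    have h := hker z hz
    rwa [hα, hβ, smul_zero, h₁, zero_add] at h

/-- **Injectivity on eigen-pairs.** If `Λ₁, Λ₂` are BOTH `𝕋̃`-eigen on `H₁(X₀(M), ℤ)` with the same
character `χ` (`ker χ` maximal, `(2 : k) ≠ 0`, not Eisenstein) and `Λ₁∘α_* + Λ₂∘β_*` vanishes on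
`H₁(X₀(Mℓ), ℤ)`, then `Λ₁` and `Λ₂` vanish on `H₁(X₀(M), ℤ)` (`χ(s)` is a unit). The pair version of
`exists_apply_dualMap_sub_ne_zero_of_ribet1984_iharaLemma`. [cite: Ribet1984ICM, Thm. 4.1]
[cite: DarmonDiamondTaylor1995, Lemma 4.28 (a), Lemma 4.30 (b), §4.5 pp. 135–137] -/
theorem apply_eq_zero_of_eigen_of_ribet1984_iharaLemma (hI : ribet1984_iharaLemma) (hℓM : ¬ ℓ ∣ M)
    (Λ₁ Λ₂ : Module.Dual ℂ (CuspForm (Gamma0 M) 2) → k) (χ : HeckeRing0.primeTo M 2 (M * ℓ) →+* k)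
    (hΛ₁ : ∀ (s : HeckeRing0.primeTo M 2 (M * ℓ)), ∀ x ∈ periodHomology M,
      Λ₁ ((s : HeckeRing0 M 2) • x) = χ s * Λ₁ x)
    (hΛ₂ : ∀ (s : HeckeRing0.primeTo M 2 (M * ℓ)), ∀ x ∈ periodHomology M,
      Λ₂ ((s : HeckeRing0 M 2) • x) = χ s * Λ₂ x)
    (h𝔫 : (RingHom.ker χ).IsMaximal) (h2 : (2 : k) ≠ 0)
    (hE : ¬ HeckeRing0.primeTo.IsEisenstein (RingHom.ker χ))
    (hker : ∀ z ∈ periodHomology (M * ℓ),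
      Λ₁ ((degeneracyMap0 M (M * ℓ) 1 2).dualMap z) +
        Λ₂ ((degeneracyMap0 M (M * ℓ) ℓ 2).dualMap z) = 0)
    {x : Module.Dual ℂ (CuspForm (Gamma0 M) 2)} (hx : x ∈ periodHomology M) :
    Λ₁ x = 0 ∧ Λ₂ x = 0 := by
  have h2' : (2 : HeckeRing0.primeTo M 2 (M * ℓ)) ∉ RingHom.ker χ := by
    rw [RingHom.mem_ker, map_ofNat]; exact h2
  obtain ⟨s, hs, hann⟩ :=
    exists_forall_apply_smul_eq_zero_of_ribet1984_iharaLemma (k := k) hI hℓM (RingHom.ker χ) h𝔫 h2' hE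
  have hu := isUnit_map_of_not_mem_ker χ h𝔫 hs
  obtain ⟨h₁, h₂⟩ := hann Λ₁ Λ₂ (apply_zero_eq_zero_of_eigen Λ₁ χ hΛ₁)
    (apply_zero_eq_zero_of_eigen Λ₂ χ hΛ₂) hker x hx
  rw [hΛ₁ s x hx] at h₁
  rw [hΛ₂ s x hx] at h₂
  exact ⟨hu.mul_right_eq_zero.mp h₁, hu.mul_right_eq_zero.mp h₂⟩

end Annihilator

end Summit.BirchSwinnertonDyer.Rank1Residual.LevelLowering

end
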